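import Mathlib.NumberTheory.NumberField.Cyclotomic.Galois
import Mathlib.NumberTheory.NumberField.Ideal.Basic
import Mathlib.NumberTheory.JacobiSum.Basic
import Mathlib.NumberTheory.MulChar.Lemmas
import HarnessLib

/-!
# Stickelberger's theorem for `ι θ₂` on primes of degree one, via the Jacobi sum `J(χ, χ)`
(Schoof, Theorem 9.5 for `θ₂`; Kummer 1847)

Let `p` be an odd prime and `K = ℚ(ζ_p)`, `G = Gal(K/ℚ) = {σ_a : a ∈ (ℤ/p)ˣ}`, `σ_a(ζ_p) = ζ_p^a`.
The Stickelberger ideal of `ℤ[G]` contains `θ₂ = Σ_a ⌊2a/p⌋ σ_a⁻¹ = Σ_{p/2 < a < p} σ_a⁻¹`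
(`= f₁`, [Schoof2009, Proposition 9.2]) and hence `ι θ₂ = Σ_{1 ≤ a ≤ (p-1)/2} σ_a⁻¹`.
[Schoof2009, Theorem 9.5] (Kummer 1847 for `ℚ(ζ_p)`, Stickelberger 1890 in general) says that
`𝔩^θ` is principal for every prime `𝔩` of degree one and every `θ` in the Stickelberger ideal;
Schoof's proof goes through Gauss sums and Kummer theory. For the single element `ι θ₂` there is
a classical shortcut inside `K`: the **Jacobi sum** `J(χ, χ) = Σ_α χ(α) χ(1 - α)` of the `p`-th
power residue character `χ` modulo `𝔩` generates `𝔩^(ιθ₂)`. This file proves exactly that: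

* `Catalan.sum_pow_mul_one_sub_pow_eq_zero` — `Σ_α α^A (1-α)^B = 0` in a finite field when
  `A + B < #F - 1`;
* `Catalan.exists_mulChar_apply_eq_pow` — the power residue character with values in `μ_p ⊂ R`
  lifting `α ↦ α^((#F-1)/p)` along a reduction map `R → F`;
* `Catalan.map_jacobiSum_pow_pow_eq_zero` — `J(χ^a, χ^b) ≡ 0 (mod 𝔩)` for `a + b < p`;
* `Catalan.smul_jacobiSum_eq` — `σ_c J(χ, χ) = J(χ^c, χ^c)`;
* `Catalan.isPrincipal_prod_smul_of_absNorm_prime` — **for an ideal `𝔩` of `ℤ[ζ_p]` of prime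
  norm `ℓ ≠ p`, `∏_{1 ≤ a ≤ (p-1)/2} σ_a⁻¹(𝔩) = (J(χ, χ))` is principal.** The divisibility
  `σ_a⁻¹(𝔩) ∣ (J)` for `a` in the first half is the vanishing `J(χ^a, χ^a) ≡ 0 (mod 𝔩)`; the
  conjugates are pairwise distinct because the decomposition group of `𝔩` is trivial
  (`ℓ ≡ 1 (mod p)`, Mathlib's `IsCyclotomicExtension.Rat.mem_zpowers_galEquivZMod_of_mem_stabilizer`);
  equality follows from `(J)(ιJ) = (ℓ) = ∏_{all a} σ_a⁻¹(𝔩)` (`jacobiSum_mul_jacobiSum_inv` and a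
  norm count).

This is the input `hKS` of `Catalan.theoremI_of_isPrincipal` (`CatalanStickelbergerBridge`), which
turns it into Mihăilescu's Theorem I; see `CatalanTheoremI`. No named fact is introduced.

## References

* R. Schoof, *Catalan's Conjecture*, Universitext, Springer 2009 [Schoof2009], Chapter 9
  (Lemma 9.1, Proposition 9.2, Theorem 9.5, Exercise 9.6; book pp. 55–60) — held,
  `lit read book:schoof2009-catalan-s-conjecture` (PDF pp. 139–146).
* K. Ireland, M. Rosen, *A Classical Introduction to Modern Number Theory*, GTM 84, Chapter 8
  (Jacobi sums) and Chapter 11 (the Stickelberger relation) — for the Jacobi-sum form of Kummer's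
  factorisation.
-/

namespace Literature.NumberTheory.DiophantineGeometry

namespace Catalan

open Finset NumberField

open scoped Pointwise

/-! ### A character sum over a finite field -/

/-- In a finite field `F`, `Σ_α α^A (1 - α)^B = 0` whenever `A + B < #F - 1`: expand
`(1 - α)^B` and use `Σ_α α^i = 0` for `i < #F - 1`. (This is the vanishing half of the
congruence for Jacobi sums, [Schoof2009, proof of Theorem 9.5] in the Jacobi-sum form of
Kummer.) [folklore] -/
theorem sum_pow_mul_one_sub_pow_eq_zero {F : Type*} [Field F] [Fintype F] {A B : ℕ}
    (h : A + B < Fintype.card F - 1) : ∑ α : F, α ^ A * (1 - α) ^ B = 0 := by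
  have hexp : ∀ α : F, (1 - α) ^ B
      = ∑ j ∈ range (B + 1), ((-1 : F) ^ j * (B.choose j : F)) * α ^ j := by
    intro α
    rw [sub_eq_add_neg, add_comm, add_pow]
    refine sum_congr rfl fun j _ => ?_
    rw [one_pow, mul_one, neg_pow]
    ring
  simp_rw [hexp, Finset.mul_sum]
  rw [Finset.sum_comm]
  refine sum_eq_zero fun j hj => ?_
  have : ∑ α : F, α ^ A * ((-1 : F) ^ j * (B.choose j : F) * α ^ j)
      = ((-1 : F) ^ j * (B.choose j : F)) * ∑ α : F, α ^ (A + j) := by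
    rw [Finset.mul_sum]
    exact sum_congr rfl fun α _ => by rw [pow_add]; ring
  rw [this, FiniteField.sum_pow_lt_card_sub_one F (A + j) (by have := mem_range.mp hj; omega),
    mul_zero]

/-! ### Lifting the `p`-th power residue character to characteristic zero -/

section Character

variable {p : ℕ} [hp : Fact p.Prime] {R : Type*} [CommRing R]
  {F : Type*} [Field F] [Fintype F] [DecidableEq F]

/-- **The `p`-th power residue character with values in characteristic zero.** Let `R` be a
domain containing a primitive `p`-th root of unity `z`, `F` a finite field and `φ : R → F` a ring
homomorphism such that `φ z` is still a primitive `p`-th root of unity (so `p ∣ #F - 1`). Then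
there is a multiplicative character `χ : F → R` with values in the powers of `z` lifting the
character `α ↦ α ^ ((#F-1)/p)`: `φ (χ α) = α ^ ((#F-1)/p)` for all `α`. (For `R = ℤ[ζ_p]` and
`φ` the reduction modulo a prime `𝔩 ∤ p` this is the power residue symbol `(·/𝔩)_p`,
[Schoof2009, Chapter 9, the character `χ` of Theorem 9.5].) [folklore] -/
theorem exists_mulChar_apply_eq_pow (φ : R →+* F) {z : R} (hz : IsPrimitiveRoot z p)
    (hzφ : IsPrimitiveRoot (φ z) p) :
    ∃ χ : MulChar F R, (∀ α : F, φ (χ α) = α ^ ((Fintype.card F - 1) / p)) ∧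
      (∀ u : Fˣ, ∃ m : ℕ, χ u = z ^ m) := by
  -- `p ∣ #Fˣ`
  have hpF : p ∣ Fintype.card Fˣ := by
    have hu := hzφ.isUnit hp.out.ne_zero
    have h1 : IsPrimitiveRoot hu.unit p := IsPrimitiveRoot.coe_units_iff.mp (by simpa using hzφ)
    rw [h1.eq_orderOf]
    exact orderOf_dvd_card
  rw [Fintype.card_units] at hpF
  set d := (Fintype.card F - 1) / p with hd
  have hdp : d * p = Fintype.card F - 1 := Nat.div_mul_cancel hpF
  -- a generator `g` of `Fˣ`; `η = g ^ d` is a `p`-th root of unity, hence `η = (φ z) ^ t`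
  obtain ⟨g, hg⟩ := IsCyclic.exists_generator (α := Fˣ)
  have hgd : ((g : F) ^ d) ^ p = 1 := by
    rw [← pow_mul, hdp, ← Fintype.card_units, ← Units.val_pow_eq_pow_val, pow_card_eq_one,
      Units.val_one]
  obtain ⟨t, -, ht⟩ := hzφ.eq_pow_of_pow_eq_one hgd
  -- the character sending `g` to `z ^ t`
  have hw : IsUnit (z ^ t) := (hz.isUnit hp.out.ne_zero).pow t
  have hwroot : hw.unit ∈ rootsOfUnity (Fintype.card Fˣ) R := by
    rw [mem_rootsOfUnity, Units.ext_iff, Units.val_pow_eq_pow_val, IsUnit.unit_spec,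
      Units.val_one, Fintype.card_units, ← hdp, ← pow_mul, show t * (d * p) = p * (t * d) by ring,
      pow_mul, hz.pow_eq_one, one_pow]
  refine ⟨MulChar.ofRootOfUnity hwroot hg, fun α => ?_, fun u => ?_⟩
  · by_cases hα : α = 0
    · rw [hα, MulChar.map_nonunit _ not_isUnit_zero, map_zero, zero_pow]
      intro hd0
      rw [hd0, zero_mul] at hdp
      have := Fintype.one_lt_card (α := F)
      omega
    · obtain ⟨k, hk⟩ := (Submonoid.mem_powers_iff _ _).mp
        (mem_powers_iff_mem_zpowers.mpr (hg (Units.mk0 α hα)))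
      have hαk : α = (g : F) ^ k := by
        rw [← Units.val_pow_eq_pow_val, hk, Units.val_mk0]
      rw [hαk, map_pow, MulChar.ofRootOfUnity_spec, IsUnit.unit_spec, map_pow, map_pow, ht,
        ← pow_mul, ← pow_mul, mul_comm]
  · obtain ⟨k, hk⟩ := (Submonoid.mem_powers_iff _ _).mp (mem_powers_iff_mem_zpowers.mpr (hg u))
    refine ⟨t * k, ?_⟩
    rw [← hk, Units.val_pow_eq_pow_val, map_pow, MulChar.ofRootOfUnity_spec, IsUnit.unit_spec,
      pow_mul]

omit [DecidableEq F] in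
/-- Reduction of Jacobi sums of powers of a lifted character: if `φ (χ α) = α ^ d` for all `α`
then `φ (J(χ^a, χ^b)) = Σ_α α^(d a) (1 - α)^(d b)` for `a, b ≥ 1`.
[cite: Schoof2009, Theorem 9.5 (proof)] -/
theorem map_jacobiSum_pow_pow (φ : R →+* F) {χ : MulChar F R} {d : ℕ}
    (hχ : ∀ α : F, φ (χ α) = α ^ d) {a b : ℕ} (ha : a ≠ 0) (hb : b ≠ 0) :
    φ (jacobiSum (χ ^ a) (χ ^ b)) = ∑ α : F, α ^ (d * a) * (1 - α) ^ (d * b) := by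
  rw [jacobiSum, map_sum]
  refine sum_congr rfl fun α _ => ?_
  rw [map_mul, MulChar.pow_apply' χ ha, MulChar.pow_apply' χ hb, map_pow, map_pow, hχ, hχ,
    pow_mul, pow_mul]

omit [DecidableEq F] in
/-- **Vanishing of Jacobi sums modulo `𝔩`**: with `φ (χ α) = α ^ d` and `d (a + b) < #F - 1`,
`φ (J(χ^a, χ^b)) = 0`. For `d = (#F-1)/p` the condition is `a + b < p`; this is the source of
the exponents `⌊·⌋` in Stickelberger's element. [cite: Schoof2009, Theorem 9.5 (proof)] -/
theorem map_jacobiSum_pow_pow_eq_zero (φ : R →+* F) {χ : MulChar F R} {d : ℕ}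
    (hχ : ∀ α : F, φ (χ α) = α ^ d) {a b : ℕ} (ha : a ≠ 0) (hb : b ≠ 0)
    (hab : d * a + d * b < Fintype.card F - 1) : φ (jacobiSum (χ ^ a) (χ ^ b)) = 0 := by
  rw [map_jacobiSum_pow_pow φ hχ ha hb]
  exact sum_pow_mul_one_sub_pow_eq_zero hab

omit [DecidableEq F] in
/-- The Galois action on a Jacobi sum acts on the character: if `σ` raises the values of `χ` to
the `c`-th power (`c ≥ 1`), then `σ (J(χ, χ)) = J(χ^c, χ^c)`. [cite: Schoof2009, Exercise 9.6 (b)] -/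
theorem smul_jacobiSum_eq {G : Type*} [Group G] [MulSemiringAction G R] (σ : G) (χ : MulChar F R)
    {c : ℕ} (hc : c ≠ 0) (hσ : ∀ α : F, σ • χ α = (χ α) ^ c) :
    σ • jacobiSum χ χ = jacobiSum (χ ^ c) (χ ^ c) := by
  rw [jacobiSum, jacobiSum, Finset.smul_sum]
  refine sum_congr rfl fun α _ => ?_
  rw [smul_mul', hσ, hσ, MulChar.pow_apply' χ hc, MulChar.pow_apply' χ hc]

end Character

/-! ### Galois conjugates of ideals of `ℤ[ζ_p]` -/

section Cyclotomic

variable {p : ℕ} [hp : Fact p.Prime] {K : Type*} [Field K] [NumberField K]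
  [IsCyclotomicExtension {p} ℚ K]

omit hp [IsCyclotomicExtension {p} ℚ K] in
/-- Galois-conjugate ideals have the same norm. [folklore] -/
theorem absNorm_smul (σ : K ≃ₐ[ℚ] K) (I : Ideal (𝓞 K)) :
    Ideal.absNorm (σ • I) = Ideal.absNorm I := by
  let e : 𝓞 K ≃+* 𝓞 K := MulSemiringAction.toRingEquiv _ (𝓞 K) σ
  have he : σ • I = I.map (e : 𝓞 K →+* 𝓞 K) := by
    rw [Ideal.pointwise_smul_def]
    rfl
  rw [Ideal.absNorm_apply, Ideal.absNorm_apply, Submodule.cardQuot_apply, Submodule.cardQuot_apply]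
  exact (Nat.card_congr (Ideal.quotientEquiv I (σ • I) e he).toEquiv).symm

omit [NumberField K] [IsCyclotomicExtension {p} ℚ K] in
/-- For an odd prime `p`, `(ℤ/p)ˣ` is the disjoint union of the "first half"
`{a : a mod p ≤ (p-1)/2}` and its negative. [folklore] -/
theorem prod_units_eq_prod_filter_mul {M : Type*} [CommMonoid M] (hpo : Odd p)
    (f : (ZMod p)ˣ → M) :
    ∏ u : (ZMod p)ˣ, f u =
      (∏ a ∈ Finset.univ.filter (fun a : (ZMod p)ˣ => (a : ZMod p).val ≤ (p - 1) / 2), f a) *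
      (∏ a ∈ Finset.univ.filter (fun a : (ZMod p)ˣ => (a : ZMod p).val ≤ (p - 1) / 2), f (-a)) := by
  classical
  haveI : Fact (1 < p) := ⟨hp.out.one_lt⟩
  set S := Finset.univ.filter (fun a : (ZMod p)ˣ => (a : ZMod p).val ≤ (p - 1) / 2) with hS
  -- `val (-a) = p - val a` for units
  have hvalneg : ∀ a : (ZMod p)ˣ, ((-a : (ZMod p)ˣ) : ZMod p).val = p - (a : ZMod p).val := by
    intro a
    rw [Units.val_neg, ZMod.val_neg_of_ne_zero]
  have hval0 : ∀ a : (ZMod p)ˣ, 0 < (a : ZMod p).val := fun a => by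
    rw [Nat.pos_iff_ne_zero, Ne, ZMod.val_eq_zero]; exact a.ne_zero
  have hvalp : ∀ a : (ZMod p)ˣ, (a : ZMod p).val < p := fun a => ZMod.val_lt _
  obtain ⟨k, hk⟩ := hpo
  have hmem : ∀ a : (ZMod p)ˣ, a ∈ S ↔ (a : ZMod p).val ≤ (p - 1) / 2 := fun a => by
    rw [hS, mem_filter]; simp
  -- `univ = S ∪ (-S)` disjointly
  have hdisj : Disjoint S (S.image fun a => -a) := by
    rw [Finset.disjoint_left]
    intro a ha ha'
    rw [mem_image] at ha'
    obtain ⟨b, hb, rfl⟩ := ha'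
    rw [hmem] at ha hb
    rw [hvalneg] at ha
    have := hval0 b
    omega
  have hunion : (Finset.univ : Finset (ZMod p)ˣ) = S ∪ S.image fun a => -a := by
    ext a
    simp only [mem_univ, mem_union, mem_image, true_iff]
    by_cases ha : (a : ZMod p).val ≤ (p - 1) / 2
    · exact Or.inl ((hmem a).mpr ha)
    · refine Or.inr ⟨-a, (hmem _).mpr ?_, neg_neg a⟩
      rw [hvalneg]
      have := hvalp a
      omega
  rw [hunion, prod_union hdisj, prod_image fun a _ b _ h => neg_inj.mp h]

/-! ### Stickelberger's theorem for `ι θ₂` on primes of degree one -/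

/-- **Stickelberger's theorem for the element `ι θ₂ = Σ_{1 ≤ a ≤ (p-1)/2} σ_a⁻¹`, on primes of
degree one** ([Schoof2009, Theorem 9.5] for `θ₂ = f₁`; E. E. Kummer 1847). Let `p` be an odd
prime, `K` a `p`-th cyclotomic field and `𝔩` an ideal of `𝓞 K = ℤ[ζ_p]` of prime norm `ℓ ≠ p`
(a prime of residue degree one not above `p`). Then `∏_{1 ≤ a ≤ (p-1)/2} σ_a⁻¹(𝔩)` is
principal: it is generated by the Jacobi sum `J(χ, χ) = Σ_α χ(α) χ(1 - α)` of the `p`-th power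
residue character `χ` modulo `𝔩` (`χ(α) ≡ α^((ℓ-1)/p) (mod 𝔩)`, values in `μ_p`). Proof:
`σ_c J(χ,χ) = J(χ^c, χ^c) ≡ Σ_α (α(1-α))^(c(ℓ-1)/p) ≡ 0 (mod 𝔩)` for `2c < p`, so every
`σ_c⁻¹(𝔩)`, `c` in the first half, divides `(J)`, and these are distinct primes (the decomposition
group of `𝔩` is trivial as `ℓ ≡ 1 (mod p)`); symmetrically for `J(χ⁻¹, χ⁻¹) = ι J` and the
other half; since `∏_{all c} σ_c⁻¹(𝔩) = (ℓ) = (J)(ι J)`, equality follows.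
[cite: Schoof2009, Theorem 9.5] -/
theorem isPrincipal_prod_smul_of_absNorm_prime (hpo : Odd p) {ζ : K} (hζ : IsPrimitiveRoot ζ p)
    (𝔩 : Ideal (𝓞 K)) (hprime : (Ideal.absNorm 𝔩).Prime) (hne : Ideal.absNorm 𝔩 ≠ p) :
    (∏ a ∈ Finset.univ.filter (fun a : (ZMod p)ˣ => (a : ZMod p).val ≤ (p - 1) / 2),
      (IsCyclotomicExtension.Rat.galEquivZMod p K).symm a⁻¹ • 𝔩).IsPrincipal := by
  classical
  -- ### Setup: the residue field `F = 𝓞 K ⧸ 𝔩` of prime order `ℓ`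
  haveI : Fact (1 < p) := ⟨hp.out.one_lt⟩
  have hp3 : 3 ≤ p := by
    have := hp.out.two_le
    obtain ⟨k, hk⟩ := hpo
    omega
  set ℓ := Ideal.absNorm 𝔩 with hℓdef
  haveI h𝔩p : 𝔩.IsPrime :=
    Ideal.isPrime_of_irreducible_absNorm ((Nat.irreducible_iff_nat_prime _).mpr hprime)
  have h𝔩0 : 𝔩 ≠ ⊥ := by
    rintro rfl
    rw [hℓdef, Ideal.absNorm_bot] at hprime
    exact Nat.not_prime_zero hprime
  haveI h𝔩m : 𝔩.IsMaximal := h𝔩p.isMaximal h𝔩0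
  letI : Field (𝓞 K ⧸ 𝔩) := Ideal.Quotient.field 𝔩
  letI : Fintype (𝓞 K ⧸ 𝔩) := Fintype.ofFinite _
  have hcardF : Fintype.card (𝓞 K ⧸ 𝔩) = ℓ := by
    rw [hℓdef, Ideal.absNorm_apply, Submodule.cardQuot_apply, Nat.card_eq_fintype_card]
  haveI : Fact ℓ.Prime := ⟨hprime⟩
  have hℓp : ℓ.Coprime p := (Nat.coprime_primes hprime hp.out).mpr hne
  haveI : 𝔩.LiesOver (Ideal.span {(ℓ : ℤ)}) :=
    ⟨by rw [Ideal.under_def, ← Ideal.span_singleton_absNorm hprime]⟩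
  -- `ζ` stays a primitive `p`-th root of unity modulo `𝔩`; hence `p ∣ ℓ - 1`
  set z : 𝓞 K := hζ.toInteger with hzdef
  have hz : IsPrimitiveRoot z p := hζ.toInteger_isPrimitiveRoot
  set φ : 𝓞 K →+* 𝓞 K ⧸ 𝔩 := Ideal.Quotient.mk 𝔩 with hφdef
  have hzφ : IsPrimitiveRoot (φ z) p := hz.idealQuotient_mk hprime.one_lt.ne' hℓp
  -- ### The character and its Jacobi sums
  obtain ⟨χ, hχ, hχval⟩ := exists_mulChar_apply_eq_pow φ hz hzφ
  set d := (Fintype.card (𝓞 K ⧸ 𝔩) - 1) / p with hddef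
  have hpd : p ∣ Fintype.card (𝓞 K ⧸ 𝔩) - 1 := by
    have hu := hzφ.isUnit hp.out.ne_zero
    have h1 : IsPrimitiveRoot hu.unit p := IsPrimitiveRoot.coe_units_iff.mp (by simpa using hzφ)
    rw [← Fintype.card_units, h1.eq_orderOf]
    exact orderOf_dvd_card
  have hdp : d * p = Fintype.card (𝓞 K ⧸ 𝔩) - 1 := Nat.div_mul_cancel hpd
  have hd0 : 0 < d := by
    rw [Nat.pos_iff_ne_zero]
    intro hd0
    rw [hd0, zero_mul] at hdp
    have := Fintype.one_lt_card (α := 𝓞 K ⧸ 𝔩)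
    omega
  -- values of `χ` are `p`-th roots of unity (or `0`), so the Galois group acts by `χ ↦ χ^c`
  have hχp : ∀ α : 𝓞 K ⧸ 𝔩, χ α ^ p = 1 ∨ χ α = 0 := by
    intro α
    by_cases hα : IsUnit α
    · obtain ⟨m, hm⟩ := hχval hα.unit
      rw [IsUnit.unit_spec] at hm
      left
      rw [hm, ← pow_mul, mul_comm, pow_mul, hz.pow_eq_one, one_pow]
    · right
      exact MulChar.map_nonunit χ hα
  set σ_ := (IsCyclotomicExtension.Rat.galEquivZMod p K).symm with hσdef
  have hσval : ∀ (c : (ZMod p)ˣ) (α : 𝓞 K ⧸ 𝔩), σ_ c • χ α = χ α ^ (c : ZMod p).val := by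
    intro c α
    rcases hχp α with h1 | h0
    · rw [IsCyclotomicExtension.Rat.galEquivZMod_smul_of_pow_eq p K _ h1, hσdef,
        MulEquiv.apply_symm_apply]
    · rw [h0, smul_zero, zero_pow]
      rw [Ne, ZMod.val_eq_zero]
      exact c.ne_zero
  have hval0 : ∀ c : (ZMod p)ˣ, (c : ZMod p).val ≠ 0 := fun c => by
    rw [Ne, ZMod.val_eq_zero]; exact c.ne_zero
  set J : 𝓞 K := jacobiSum χ χ with hJdef
  -- `σ_c J = J(χ^c, χ^c)`, which lies in `𝔩` when `2 c < p`
  have hσJ : ∀ c : (ZMod p)ˣ, σ_ c • J = jacobiSum (χ ^ (c : ZMod p).val) (χ ^ (c : ZMod p).val) :=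
    fun c => smul_jacobiSum_eq (σ_ c) χ (hval0 c) (hσval c)
  have hJmem : ∀ c : (ZMod p)ˣ, (c : ZMod p).val ≤ (p - 1) / 2 → σ_ c • J ∈ 𝔩 := by
    intro c hc
    rw [hσJ c, ← Ideal.Quotient.eq_zero_iff_mem]
    refine map_jacobiSum_pow_pow_eq_zero φ hχ (hval0 c) (hval0 c) ?_
    rw [← hdp]
    have : 2 * (c : ZMod p).val < p := by omega
    nlinarith
  -- ### The conjugates `σ_{c⁻¹} 𝔩` are pairwise distinct: the decomposition group is trivial
  have hstab : ∀ τ : K ≃ₐ[ℚ] K, τ • 𝔩 = 𝔩 → τ = 1 := by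
    intro τ hτ
    have hmem := IsCyclotomicExtension.Rat.mem_zpowers_galEquivZMod_of_mem_stabilizer p K ℓ 𝔩 hℓp
      (MulAction.mem_stabilizer_iff.mpr hτ)
    have h1 : ZMod.unitOfCoprime ℓ hℓp = 1 := by
      apply Units.ext
      rw [ZMod.coe_unitOfCoprime, Units.val_one, ← hcardF, ← Nat.sub_add_cancel
        Fintype.card_pos, ← hdp, Nat.cast_add, Nat.cast_mul, ZMod.natCast_self, mul_zero,
        zero_add, Nat.cast_one]
    rw [h1, Subgroup.zpowers_one_eq_bot, Subgroup.mem_bot] at hmem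
    exact (MulEquiv.map_eq_one_iff _).mp hmem
  have hinj : ∀ c₁ c₂ : (ZMod p)ˣ, σ_ c₁ • 𝔩 = σ_ c₂ • 𝔩 → c₁ = c₂ := by
    intro c₁ c₂ h
    have : (σ_ c₂)⁻¹ * σ_ c₁ = 1 := hstab _ (by rw [mul_smul, h, inv_smul_smul])
    rw [inv_mul_eq_one] at this
    exact σ_.injective this.symm
  -- ### Divisibility: `T ∣ (J)` and `T' ∣ (ι J)`, with `T T' = (ℓ)`
  set S := Finset.univ.filter (fun a : (ZMod p)ˣ => (a : ZMod p).val ≤ (p - 1) / 2) with hSdef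
  have hSmem : ∀ a, a ∈ S ↔ (a : ZMod p).val ≤ (p - 1) / 2 := fun a => by
    rw [hSdef, mem_filter]; simp
  have hmax : ∀ τ : K ≃ₐ[ℚ] K, (τ • 𝔩).IsMaximal := fun τ => by
    haveI : (τ • 𝔩).IsPrime := Ideal.IsPrime.smul τ
    refine Ideal.IsPrime.isMaximal inferInstance ?_
    rw [Ideal.pointwise_smul_def]
    exact (Ideal.map_eq_bot_iff_of_injective (MulSemiringAction.toRingEquiv _ (𝓞 K) τ).injective).not.mpr h𝔩0
  have hcopr : ∀ (f : (ZMod p)ˣ → (ZMod p)ˣ), Function.Injective f → ∀ T : Finset (ZMod p)ˣ,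
      (T : Set (ZMod p)ˣ).Pairwise (Function.onFun IsCoprime fun a => σ_ (f a) • 𝔩) := by
    intro f hf T a _ b _ hab
    exact Ideal.isCoprime_iff_sup_eq.mpr ((hmax _).coprime_of_ne (hmax _)
      fun h => hab (hf (hinj _ _ h)))
  have hσnat : ∀ (τ : K ≃ₐ[ℚ] K) (n : ℕ), τ • (n : 𝓞 K) = n := fun τ n => by
    rw [← MulSemiringAction.toRingHom_apply, map_natCast]
  -- `T ∣ (J)`
  have hT : ∏ a ∈ S, σ_ a⁻¹ • 𝔩 ∣ Ideal.span {J} := by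
    refine Finset.prod_dvd_of_coprime (hcopr (fun a => a⁻¹) inv_injective S) fun a ha => ?_
    rw [Ideal.dvd_span_singleton, map_inv, Ideal.mem_inv_pointwise_smul_iff]
    exact hJmem a ((hSmem a).mp ha)
  -- `ι J = J(χ⁻¹, χ⁻¹)` and `T' ∣ (ι J)`
  set J' : 𝓞 K := σ_ (-1) • J with hJ'def
  have hT' : ∏ a ∈ S, σ_ (-a)⁻¹ • 𝔩 ∣ Ideal.span {J'} := by
    refine Finset.prod_dvd_of_coprime (hcopr (fun a => (-a)⁻¹)
      (fun a b h => neg_inj.mp (inv_injective h)) S) fun a ha => ?_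
    rw [Ideal.dvd_span_singleton, map_inv, Ideal.mem_inv_pointwise_smul_iff, hJ'def, ← mul_smul,
      ← map_mul, neg_mul_neg, mul_one]
    exact hJmem a ((hSmem a).mp ha)
  -- `∏_{all c} σ_{c} 𝔩 = (ℓ)` by comparing norms
  have hnorm𝔩 : ∀ τ : K ≃ₐ[ℚ] K, Ideal.absNorm (τ • 𝔩) = ℓ := fun τ => by
    rw [absNorm_smul, hℓdef]
  have hrank : Module.finrank ℤ (𝓞 K) = p - 1 := by
    rw [RingOfIntegers.rank, IsCyclotomicExtension.Rat.finrank p K, Nat.totient_prime hp.out]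
  have hnormℓ : Ideal.absNorm (Ideal.span {(ℓ : 𝓞 K)}) = ℓ ^ (p - 1) := by
    rw [Ideal.absNorm_span_singleton, ← map_natCast (algebraMap ℤ (𝓞 K)), Algebra.norm_algebraMap,
      hrank, Int.natAbs_pow, Int.natAbs_natCast]
  have hN : ∏ c : (ZMod p)ˣ, σ_ c • 𝔩 = Ideal.span {(ℓ : 𝓞 K)} := by
    have hdvd : ∏ c : (ZMod p)ˣ, σ_ c • 𝔩 ∣ Ideal.span {(ℓ : 𝓞 K)} := by
      refine Finset.prod_dvd_of_coprime (hcopr id Function.injective_id _) fun c _ => ?_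
      rw [Ideal.dvd_span_singleton]
      have := Ideal.smul_mem_pointwise_smul (σ_ c) _ 𝔩 (Ideal.absNorm_mem 𝔩)
      rwa [hσnat] at this
    -- equal norms
    obtain ⟨U, hU⟩ := hdvd
    have hnormU : Ideal.absNorm U = 1 := by
      have h1 := congrArg Ideal.absNorm hU
      rw [hnormℓ, map_mul, map_prod] at h1
      simp only [hnorm𝔩, prod_const, card_univ, ZMod.card_units_eq_totient,
        Nat.totient_prime hp.out] at h1
      exact (mul_eq_left₀ (pow_ne_zero _ hprime.ne_zero)).mp h1.symm
    rw [Ideal.absNorm_eq_one_iff] at hnormU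
    rw [hU, hnormU, Ideal.mul_top]
  -- ### `J · J' = ℓ` (in `K`, by `jacobiSum_mul_jacobiSum_inv`)
  have hχ1 : ∀ a : ℕ, 0 < a → a < p → χ ^ a ≠ 1 := by
    intro a ha0 hap h1
    obtain ⟨g, hg⟩ := IsCyclic.exists_generator (α := (𝓞 K ⧸ 𝔩)ˣ)
    have hg1 : ((g : 𝓞 K ⧸ 𝔩) ^ (d * a)) = 1 := by
      have := congrArg (fun ψ : MulChar (𝓞 K ⧸ 𝔩) (𝓞 K) => φ (ψ g)) h1
      rwa [MulChar.pow_apply' χ ha0.ne', map_pow, hχ, ← pow_mul, MulChar.one_apply_coe,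
        map_one] at this
    have hord : orderOf g = d * p := by
      rw [orderOf_eq_card_of_forall_mem_zpowers hg, Nat.card_eq_fintype_card, Fintype.card_units,
        ← hdp]
    have hdvd : d * p ∣ d * a := by
      rw [← hord, orderOf_dvd_iff_pow_eq_one, Units.ext_iff, Units.val_pow_eq_pow_val, hg1,
        Units.val_one]
    have : p ∣ a := Nat.dvd_of_mul_dvd_mul_left hd0 hdvd
    exact absurd (Nat.le_of_dvd ha0 this) (not_le.mpr hap)
  have hJJ' : J * J' = (ℓ : 𝓞 K) := by
    have hinjK := FaithfulSMul.algebraMap_injective (𝓞 K) K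
    apply hinjK
    set χK := χ.ringHomComp (algebraMap (𝓞 K) K) with hχKdef
    have hne1 : χK ≠ 1 := (MulChar.ringHomComp_ne_one_iff hinjK).mpr (by
      simpa using hχ1 1 one_pos (by omega))
    have hne2 : χK * χK ≠ 1 := by
      rw [hχKdef, ← MulChar.ringHomComp_mul, MulChar.ringHomComp_ne_one_iff hinjK, ← sq]
      exact hχ1 2 two_pos (by omega)
    have hchar : ringChar K ≠ ringChar (𝓞 K ⧸ 𝔩) := by
      rw [ringChar.eq_zero, ne_comm]
      haveI : CharP (𝓞 K ⧸ 𝔩) (ringChar (𝓞 K ⧸ 𝔩)) := ringChar.charP _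
      obtain ⟨n, hpr, -⟩ := FiniteField.card (𝓞 K ⧸ 𝔩) (ringChar (𝓞 K ⧸ 𝔩))
      exact hpr.ne_zero
    have hmain := jacobiSum_mul_jacobiSum_inv hchar hne1 hne1 hne2
    rw [hχKdef, MulChar.ringHomComp_inv, jacobiSum_ringHomComp, jacobiSum_ringHomComp,
      hcardF] at hmain
    rw [map_mul, map_natCast]
    -- `J' = J(χ⁻¹, χ⁻¹)` as `χ⁻¹ = χ^(p-1)`
    have hχinv : χ ^ ((-1 : (ZMod p)ˣ) : ZMod p).val = χ⁻¹ := by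
      have hv : ((-1 : (ZMod p)ˣ) : ZMod p).val + 1 = p := by
        rw [Units.val_neg, Units.val_one, ZMod.val_neg_of_ne_zero, ZMod.val_one]; omega
      have hχpow : χ ^ p = 1 := by
        refine MulChar.ext fun u => ?_
        rw [MulChar.pow_apply_coe, MulChar.one_apply_coe]
        rcases hχp u with h | h
        · exact h
        · exact absurd h (by rw [← MulChar.coe_toUnitHom]; exact Units.ne_zero _)
      refine (inv_eq_of_mul_eq_one_left ?_).symm
      rw [← pow_succ, hv, hχpow]
    have hJ'eq : J' = jacobiSum χ⁻¹ χ⁻¹ := by rw [hJ'def, hσJ (-1), hχinv]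
    rw [hJ'eq]
    exact hmain
  -- ### Conclusion: `T T' = (ℓ) = (J)(J')` with `T ∣ (J)`, `T' ∣ (J')` forces `T = (J)`
  have hTT' : (∏ a ∈ S, σ_ a⁻¹ • 𝔩) * (∏ a ∈ S, σ_ (-a)⁻¹ • 𝔩)
      = Ideal.span {J} * Ideal.span {J'} := by
    rw [Ideal.span_singleton_mul_span_singleton, hJJ', ← hN,
      ← prod_units_eq_prod_filter_mul hpo (fun u => σ_ u⁻¹ • 𝔩)]
    exact Equiv.prod_comp (Equiv.inv (ZMod p)ˣ) (fun u => σ_ u • 𝔩)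
  obtain ⟨U, hU⟩ := hT
  obtain ⟨U', hU'⟩ := hT'
  have hTT'0 : (∏ a ∈ S, σ_ a⁻¹ • 𝔩) * (∏ a ∈ S, σ_ (-a)⁻¹ • 𝔩) ≠ 0 := by
    rw [hTT', Ideal.span_singleton_mul_span_singleton, hJJ', Ne, Ideal.zero_eq_bot,
      Ideal.span_singleton_eq_bot]
    exact_mod_cast hprime.ne_zero
  have hUU' : U * U' = 1 := by
    apply mul_left_cancel₀ hTT'0
    conv_rhs => rw [mul_one, hTT', hU, hU']
    ring
  have hU1 : U = ⊤ := Ideal.isUnit_iff.mp (IsUnit.of_mul_eq_one U' hUU')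
  rw [hU1, Ideal.mul_top] at hU
  exact ⟨⟨J, hU.symm⟩⟩


end Cyclotomic

end Catalan

end Literature.NumberTheory.DiophantineGeometry
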